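import Summits.KontsevichZagierPeriods.KontsevichZagierPeriods.Theses.IsogenyCertificates
import Literature.NumberTheory.Transcendental.KZCalculus
import Literature.ModelTheory.ExponentialFields.SemialgebraicComponents
import Summits.KontsevichZagierPeriods.KontsevichZagierPeriods.Theorems.IsogenyCertificatesXMapPeriodTransferCellsBasic
import Summits.KontsevichZagierPeriods.KontsevichZagierPeriods.Theorems.IsogenyCertificatesAlgebraicModuliRealPeriodCellPeriodRep

/-!
# `AlgebraicModuliRealPeriodCell` (stmt-KontsevichZagierPeriods-18265, route IsogenyCertificates) —
line `Sketch`, stub T (x-map period transfer for real-algebraic data): basic API of the cells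

Port of the `ℚ`-line's `Theorems/IsogenyCertificatesXMapPeriodTransferCellsBasic.lean` to
REAL-ALGEBRAIC data: the moduli are real numbers `α, β` (with `IsAlgebraic ℚ α`, `IsAlgebraic ℚ β`
only where `ℚ`-semialgebraicity is concerned) and the datum polynomials are `f g : ℝ[X]` with
algebraic coefficients. The objects are always written out (no definitions):

* the real Wronskian `W = fun y => (derivative f * g - f * derivative g).eval y`;
* the CELL LOCUS `L = {y | 0 < y³ + αy + β ∧ W y ≠ 0} ⊆ ℝ`, whose connected components are the cells;
* the UNBOUNDED COMPONENT `U = connectedComponentIn {y | 0 < y³ + αy + β} (1 + |α| + |β|)` of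
  `{P > 0}` and the EGG `{P > 0} ∖ U`.

This file proves: `P > 0` at and beyond `1 + |α| + |β|`, openness, and `ℚ`-semialgebraicity of the
traces `{x : Fin 1 → ℝ | x 0 ∈ ·}` in `ℝ¹` (the form in which these sets enter `KZ.IntegralRep 1`).
The semialgebraicity over `ℚ` of sign conditions on real polynomials with ALGEBRAIC coefficients is
the foundation file's `isSemialgebraic_setOf_eval_coord` (Kontsevich–Zagier §1.1: "rational" may be
replaced by "algebraic"; Bochnak–Coste–Roy 2.2.1), applied to the cubic and to the Wronskian, whose
coefficients are algebraic (`coeff_wronskian_isAlgebraic`, via the lift to `(ℚ̄ ∩ ℝ)[X]`). The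
generic transport lemmas along `ℝ¹ ≃ₜ ℝ` (`hat_connectedComponentIn`,
`isSemialgebraic_hat_connectedComponentIn`, `finite_setOf_connectedComponentIn`,
`volume_hat_eq_zero_of_finite`) are those of the `ℚ`-line, imported.

References: M. Kontsevich, D. Zagier, *Periods* (2001), §1.1–1.2; J. Bochnak, M. Coste, M.-F. Roy,
*Real Algebraic Geometry* (1998), Thm. 2.2.1; S. Basu, R. Pollack, M.-F. Roy, *Algorithms in Real
Algebraic Geometry* (2006), Thm. 5.22.
-/

noncomputable section

open Set Polynomial MeasureTheory
open Literature.ModelTheory.ExponentialFields (IsSemialgebraic)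
open Summit.KontsevichZagierPeriods.IsogenyCertificates.XMapPeriodTransferCells
  (hat_connectedComponentIn isSemialgebraic_hat_connectedComponentIn
  finite_setOf_connectedComponentIn volume_hat_eq_zero_of_finite)
open Summit.KontsevichZagierPeriods.IsogenyCertificates.AlgRealPeriodCell.PeriodRep
  (algebraicClosure_isAlgebraic exists_map_eq_of_coeff_isAlgebraic isSemialgebraic_setOf_eval_coord
  isSemialgebraic_domain)

namespace Summit.KontsevichZagierPeriods.IsogenyCertificates.AlgRealPeriodCell.TransferCellsBasic

/-- `P(z) > 0` for every `z ≥ 1 + |α| + |β|`. [folklore] -/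
theorem cubic_pos_of_large_le (α β : ℝ) {z : ℝ} (hz : 1 + |α| + |β| ≤ z) :
    0 < z ^ 3 + α * z + β := by
  have hA : -|α| ≤ α := neg_abs_le _
  have hB : -|β| ≤ β := neg_abs_le _
  have h0A : 0 ≤ |α| := abs_nonneg _
  have h0B : 0 ≤ |β| := abs_nonneg _
  have hz1 : 1 ≤ z := by linarith
  have hz0 : 0 ≤ z := by linarith
  nlinarith [mul_le_mul_of_nonneg_left hA hz0, sq_nonneg z, mul_le_mul_of_nonneg_left hz1 hz0,
    mul_le_mul_of_nonneg_left hz hz0, mul_nonneg hz0 h0B]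

/-- `{P > 0}` is open. [folklore] -/
theorem isOpen_setOf_cubic_pos (α β : ℝ) : IsOpen {y : ℝ | 0 < y ^ 3 + α * y + β} :=
  isOpen_lt continuous_const (by fun_prop)

/-- The cell locus `{P > 0, W ≠ 0}` is open. [folklore] -/
theorem isOpen_cellLocus (α β : ℝ) (f g : ℝ[X]) :
    IsOpen {y : ℝ | 0 < y ^ 3 + α * y + β ∧
      (derivative f * g - f * derivative g).eval y ≠ 0} :=
  (isOpen_setOf_cubic_pos α β).inter
    (isOpen_ne_fun (Polynomial.continuous _) continuous_const)

/-- The point `1 + |α| + |β|` lies in the unbounded component of `{P > 0}`. [folklore] -/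
theorem large_mem_unbounded (α β : ℝ) :
    1 + |α| + |β| ∈ connectedComponentIn {y : ℝ | 0 < y ^ 3 + α * y + β} (1 + |α| + |β|) :=
  mem_connectedComponentIn (cubic_pos_of_large_le α β le_rfl)

/-- `[1 + |α| + |β|, ∞)` lies in the unbounded component of `{P > 0}`. [folklore] -/
theorem Ici_large_subset_unbounded (α β : ℝ) :
    Ici (1 + |α| + |β|) ⊆ connectedComponentIn {y : ℝ | 0 < y ^ 3 + α * y + β} (1 + |α| + |β|) :=
  (isPreconnected_Ici).subset_connectedComponentIn self_mem_Ici
    (fun _ hz => cubic_pos_of_large_le α β hz)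

/-- The unbounded component of `{P > 0}` is open. [folklore] -/
theorem isOpen_unbounded (α β : ℝ) :
    IsOpen (connectedComponentIn {y : ℝ | 0 < y ^ 3 + α * y + β} (1 + |α| + |β|)) :=
  (isOpen_setOf_cubic_pos α β).connectedComponentIn

/-! ### The Wronskian of a datum with algebraic coefficients has algebraic coefficients -/

/-- If `f, g ∈ ℝ[X]` have real algebraic coefficients then so does the Wronskian
`W = f'g − fg'`: lifting `f, g` to `F, G ∈ (ℚ̄ ∩ ℝ)[X]`, `W` is the image of `F'G − FG'`.
[folklore] -/
theorem coeff_wronskian_isAlgebraic {f g : ℝ[X]} (hf : ∀ n, IsAlgebraic ℚ (f.coeff n))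
    (hg : ∀ n, IsAlgebraic ℚ (g.coeff n)) (n : ℕ) :
    IsAlgebraic ℚ ((derivative f * g - f * derivative g).coeff n) := by
  obtain ⟨F, hF⟩ := exists_map_eq_of_coeff_isAlgebraic f hf
  obtain ⟨G, hG⟩ := exists_map_eq_of_coeff_isAlgebraic g hg
  have h : (derivative F * G - F * derivative G).map (algebraMap (↥(algebraicClosure ℚ ℝ)) ℝ) =
      derivative f * g - f * derivative g := by
    rw [Polynomial.map_sub, Polynomial.map_mul, Polynomial.map_mul, ← Polynomial.derivative_map,
      ← Polynomial.derivative_map, hF, hG]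
  rw [← h, coeff_map]
  exact algebraicClosure_isAlgebraic _

/-! ### The corresponding subsets of `ℝ¹ = Fin 1 → ℝ` are `ℚ`-semialgebraic -/

/-- `{x ∈ ℝ¹ | P(x 0) > 0}` is `ℚ`-semialgebraic for real algebraic `α, β`.
[cite: KontsevichZagier2001, §1.1] -/
theorem isSemialgebraic_hat_cubic_pos (α β : ℝ) (hα : IsAlgebraic ℚ α) (hβ : IsAlgebraic ℚ β) :
    IsSemialgebraic ℚ {x : Fin 1 → ℝ | x 0 ∈ {y : ℝ | 0 < y ^ 3 + α * y + β}} :=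
  isSemialgebraic_domain hα hβ

/-- `{x ∈ ℝ¹ | x 0 ∈ cell locus}` is `ℚ`-semialgebraic (`P > 0`, `W ≠ 0`, both with real algebraic
coefficients). [cite: KontsevichZagier2001, §1.1] -/
theorem isSemialgebraic_hat_cellLocus (α β : ℝ) (hα : IsAlgebraic ℚ α) (hβ : IsAlgebraic ℚ β)
    (f g : ℝ[X]) (hf : ∀ n, IsAlgebraic ℚ (f.coeff n)) (hg : ∀ n, IsAlgebraic ℚ (g.coeff n)) :
    IsSemialgebraic ℚ {x : Fin 1 → ℝ | x 0 ∈ {y : ℝ | 0 < y ^ 3 + α * y + β ∧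
      (derivative f * g - f * derivative g).eval y ≠ 0}} := by
  have h1 := isSemialgebraic_domain hα hβ
  have h2 := (isSemialgebraic_setOf_eval_coord (0 : Fin 1) (derivative f * g - f * derivative g)
    (coeff_wronskian_isAlgebraic hf hg)).2.1
  convert h1.inter h2.compl using 1
  ext x
  simp only [mem_setOf_eq, mem_inter_iff, mem_compl_iff, ne_eq]

/-- Every cell `{x ∈ ℝ¹ | x 0 ∈ connectedComponentIn (cell locus) y}` is `ℚ`-semialgebraic.
[cite: BasuPollackRoy2006, Thm. 5.22] -/
theorem isSemialgebraic_hat_cell (α β : ℝ) (hα : IsAlgebraic ℚ α) (hβ : IsAlgebraic ℚ β)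
    (f g : ℝ[X]) (hf : ∀ n, IsAlgebraic ℚ (f.coeff n)) (hg : ∀ n, IsAlgebraic ℚ (g.coeff n))
    (y : ℝ) :
    IsSemialgebraic ℚ {x : Fin 1 → ℝ | x 0 ∈ connectedComponentIn
      {y : ℝ | 0 < y ^ 3 + α * y + β ∧ (derivative f * g - f * derivative g).eval y ≠ 0} y} :=
  isSemialgebraic_hat_connectedComponentIn (isSemialgebraic_hat_cellLocus α β hα hβ f g hf hg) y

/-- `{x ∈ ℝ¹ | x 0 ∈ unbounded component}` is `ℚ`-semialgebraic. [cite: BasuPollackRoy2006, Thm. 5.22] -/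
theorem isSemialgebraic_hat_unbounded (α β : ℝ) (hα : IsAlgebraic ℚ α) (hβ : IsAlgebraic ℚ β) :
    IsSemialgebraic ℚ {x : Fin 1 → ℝ | x 0 ∈
      connectedComponentIn {y : ℝ | 0 < y ^ 3 + α * y + β} (1 + |α| + |β|)} :=
  isSemialgebraic_hat_connectedComponentIn (isSemialgebraic_hat_cubic_pos α β hα hβ) _

/-- `{x ∈ ℝ¹ | x 0 ∈ egg}` is `ℚ`-semialgebraic. [cite: BasuPollackRoy2006, Thm. 5.22] -/
theorem isSemialgebraic_hat_egg (α β : ℝ) (hα : IsAlgebraic ℚ α) (hβ : IsAlgebraic ℚ β) :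
    IsSemialgebraic ℚ {x : Fin 1 → ℝ | x 0 ∈ {y : ℝ | 0 < y ^ 3 + α * y + β} \
      connectedComponentIn {y : ℝ | 0 < y ^ 3 + α * y + β} (1 + |α| + |β|)} :=
  (isSemialgebraic_hat_cubic_pos α β hα hβ).diff (isSemialgebraic_hat_unbounded α β hα hβ)

/-- **Port of the registered stub `stub_cellsBasic`** of the `ℚ`-line to real-algebraic moduli and
data: the basic API above, bundled (same seven components, algebraicity hypotheses inserted right
after the corresponding binders; registered as an additive sub-goal of stub T). [folklore] -/
theorem stub_cellsBasic : (∀ (α β : ℝ) (z : ℝ), 1 + |α| + |β| ≤ z → 0 < z ^ 3 + α * z + β) ∧ (∀ (α β : ℝ), IsAlgebraic ℚ α → IsAlgebraic ℚ β → Literature.ModelTheory.ExponentialFields.IsSemialgebraic ℚ {x : Fin 1 → ℝ | x 0 ∈ {y : ℝ | 0 < y ^ 3 + α * y + β}}) ∧ (∀ (α β : ℝ), IsAlgebraic ℚ α → IsAlgebraic ℚ β → ∀ (f g : Polynomial ℝ), (∀ n, IsAlgebraic ℚ (f.coeff n)) → (∀ n, IsAlgebraic ℚ (g.coeff n)) →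 ∀ (x₀ : ℝ), Literature.ModelTheory.ExponentialFields.IsSemialgebraic ℚ {x : Fin 1 → ℝ | x 0 ∈ connectedComponentIn {y : ℝ | 0 < y ^ 3 + α * y + β ∧ (Polynomial.derivative f * g - f * Polynomial.derivative g).eval y ≠ 0} x₀}) ∧ (∀ (α β : ℝ), IsAlgebraic ℚ α → IsAlgebraic ℚ β → Literature.ModelTheory.ExponentialFields.IsSemialgebraic ℚ {x : Fin 1 → ℝ | x 0 ∈ connectedComponentIn {y : ℝ | 0 < y ^ 3 + α * y + β} (1 + |α| + |β|)}) ∧ (∀ (α β : ℝ), IsAlgebraic ℚ α → IsAlgebraic ℚ β → Literature.ModelTheory.ExponentialFields.IsSemialgebraic ℚ {x : Fin 1 → ℝ | x 0 ∈ {y : ℝ | 0 < y ^ 3 + α * y + β} \ connectedComponentIn {y : ℝ | 0 < y ^ 3 + α * y + β} (1 + |α| + |β|)}) ∧ (∀ (S : Set ℝ), Literature.ModelTheory.ExponentialFields.IsSemialgebraic ℚ {x : Fin 1 → ℝ | x 0 ∈ S} → {K : Set ℝ | ∃ y ∈ S, K = connectedComponentIn S y}.Finite) ∧ (∀ (F :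 Set ℝ), F.Finite → MeasureTheory.volume {x : Fin 1 → ℝ | x 0 ∈ F} = 0) :=
  ⟨fun α β _ hz => cubic_pos_of_large_le α β hz, isSemialgebraic_hat_cubic_pos, isSemialgebraic_hat_cell,
    isSemialgebraic_hat_unbounded, isSemialgebraic_hat_egg,
    fun _ hS => finite_setOf_connectedComponentIn hS, fun _ hF => volume_hat_eq_zero_of_finite hF⟩

end Summit.KontsevichZagierPeriods.IsogenyCertificates.AlgRealPeriodCell.TransferCellsBasic

end
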